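import Literature.NumberTheory.Transcendental.PadicLogAlgClProofs
import Literature.NumberTheory.EllipticCurves.PAdicHeightsLogProofs
import Summits.ABC.IUTFork.LanaLogLinkFrobeniusIntegers
import Summits.ABC.IUTFork.LanaLogKummer
import HarnessLib

/-!
# L-LANA objects IX quinquies bis: the log-Kummer column at the `ℚ_p` datum is UPPER SEMI-COMPATIBLE (LANA §7.2 (c), real data)

Record-only / vacuity-audit file (D-0012; seat abc-iut-c312-4, L-LANA level, plan/LLANA-SPEC N16 "log-Kummer
correspondence (Fig. 5) … upper semi-compatibility / Ind3 (§7.2 (c))") over `LanaLogKummer.lean` (gen 0: Fig. 5 as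
the data `LogKummerColumn`, the HYPOTHESIS-shaped predicate `UpperSemiCompatible := UpperSemiCommutative étI
(images after shifts)` = L6's typing of [IUTchIII] Rem. 1.2.2 (iii)) and `LanaLogLinkFrobenius(Integers).lean`
(this seat: LANA p. 26's `log : O^{×μ}_v ⥲ K̄_v` and printed log-shell `I_v` REAL at the `ℚ_p` datum, from layer L4's
Iwasawa logarithm `padicLogAlgCl` of `ℚ̄_p`); TAKES NO SIDE on [IUTchIII] Cor. 3.12.

LANA §7.2 (c) p. 40: "although the log-link and the Kummer isomorphism are not commutative, the log-shell acts as an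
upper-bound that simultaneously contains their images … even after undergoing a shift by the log-link, all required
images remain within the log-shell." THIS file, at the `ℚ_p` datum:

* `padicLogAlgCl_mem_printedLogShell_of_unitInv` — `log(O^×_v) ⊆ I_v` (for a `G_{ℚ_p}`-invariant unit `w`,
  `log w = (2p)⁻¹ · log(w^{2p})`);
* `printedLogShell_subset_range` — `I_v ⊂ ℚ_p` (invariant units are `ℚ_p`-rational, `log` is `G_{ℚ_p}`-equivariant);
* **`padicLogAlgCl_mem_printedLogShell`** — **`log(I_v) ⊆ I_v`**: the Iwasawa logarithm maps the printed log-shell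
  into itself (an element of `I_v` is `p^m · w` with `w ∈ ℤ_p^×` or `0`, and `log p = 0`);
* `padicColumn` — the TAUTOLOGICAL MODEL COLUMN of Fig. 5 at `ℚ_p`: every Frobenius-like carrier `ⁿC := ℚ̄_p` with
  `ⁿI := I_v`, log-links `:= log` (L4's `padicLogAlgCl`, a total function: `log 0 = 0`, `log p = 0`), étale carrier
  `:= ℚ̄_p` with `étI := I_v`, Kummer maps `:= id` (all copies realised in ONE model — the identifications carry no
  indeterminacy here; this is what makes it a model, not a claim about [IUTchIII]'s Kummer isomorphisms);
* **`padicColumn_upperSemiCompatible` (PROVED)** — gen 0's predicate `UpperSemiCompatible` (= L6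
  `UpperSemiCommutative`) HOLDS for this column of REAL objects: every image `ⁿ⁺ᵏKmm(logᵏ(ⁿI))` lies in `étI`.
  So the (Ind3)-shaped hypothesis of the L-LANA files is satisfiable by genuine data (its failure for junk data is
  gen 0's business: `UpperSemiCommutative` is a plain `∀ i, images i ⊆ shell`).

HONEST SCOPE: the `ℚ_p` datum only; `Kmm = id` is the model's choice (§7.2 (b) "Kummer isomorphisms from
Frobenius-like log-shells to étale-like log-shells" are isomorphisms onto copies — here the copies coincide); the
content proved is the classical `log_p(ℤ_p) ⊆ ℤ_p`-type stability, [IUTchIII] Prop. 1.2-flavoured, nothing of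
Thm. 3.11. [cite: LANA2026Report, §7.2 (b),(c) pp. 38–40, §5.1 p. 26] NOT here: any judgement.
-/

noncomputable section

namespace Summit.ABC
namespace IUTFork

open Literature.NumberTheory.Transcendental Literature.AnabelianGeometry.AbsoluteAnabelian
open scoped NNReal

variable (p : ℕ) [Fact p.Prime]

/-! ## 1. `log(O^×_v) ⊆ I_v ⊂ ℚ_p` and `log(I_v) ⊆ I_v` at the `ℚ_p` datum -/

/-- **`log(O^×_v) ⊆ I_v`**: the logarithm of a `G_{ℚ_p}`-invariant unit lies in the printed log-shell
(`(2p) · log w = log(w^{2p})` with `w^{2p}` again an invariant unit). [cite: LANA2026Report, §5.1 p. 26] -/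
theorem padicLogAlgCl_mem_printedLogShell_of_unitInv (w : unitGrp (padicVal p))
    (hw : w ∈ unitInv (padicVal p) (PadicGal p)) :
    padicLogAlgCl p ((w : (PadicAlgCl p)ˣ) : PadicAlgCl p) ∈ printedLogShell p :=
  ⟨w ^ (2 * p), Subgroup.pow_mem _ hw _, (padicLogAlgCl_unitGrp_pow p w (2 * p)).symm⟩

/-- **`I_v ⊂ ℚ_p`**: every element of the printed log-shell is `ℚ_p`-rational — it is `(2p)⁻¹ · log u` for a
`G_{ℚ_p}`-invariant unit `u`, and `log` is `G_{ℚ_p}`-equivariant (L4's `log_smul_of_mem_unitSubmonoid`), so it is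
fixed by `G_{ℚ_p}` (fixed field `= ℚ_p`, `fixed_iff_mem_range`). [cite: LANA2026Report, §5.1 p. 26] -/
theorem printedLogShell_subset_range {y : PadicAlgCl p} (hy : y ∈ printedLogShell p) :
    y ∈ Set.range (algebraMap ℚ_[p] (PadicAlgCl p)) := by
  obtain ⟨u, hu, huy⟩ := hy
  rw [← fixed_iff_mem_range]
  intro σ
  -- `σ` fixes `log u` since it fixes `u`
  have hσu : σ • ((u : (PadicAlgCl p)ˣ) : PadicAlgCl p) = ((u : (PadicAlgCl p)ˣ) : PadicAlgCl p) := by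
    have h := (mem_unitInvariants_iff (padicVal p) (PadicGal p) ⊤ u).mp hu ⟨σ, Subgroup.mem_top σ⟩
    have h' := congrArg (fun v : unitGrp (padicVal p) => ((v : (PadicAlgCl p)ˣ) : PadicAlgCl p)) h
    simpa only [unitGrp.coe_smul] using h'
  have hlog : σ • padicLogAlgCl p ((u : (PadicAlgCl p)ˣ) : PadicAlgCl p) =
      padicLogAlgCl p ((u : (PadicAlgCl p)ˣ) : PadicAlgCl p) := by
    rw [← PadicAlgCl.log_smul_of_mem_unitSubmonoid p σ (coe_unitGrp_mem_unitSubmonoid p u), hσu]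
  -- hence `σ` fixes `(2p) · y`, hence `y`
  have h2p : σ • (((2 * p : ℕ) : PadicAlgCl p) * y) = ((2 * p : ℕ) : PadicAlgCl p) * (σ • y) := by
    rw [AlgEquiv.smul_def, AlgEquiv.smul_def, map_mul, map_natCast]
  have hfix : ((2 * p : ℕ) : PadicAlgCl p) * (σ • y) = ((2 * p : ℕ) : PadicAlgCl p) * y := by
    rw [← h2p, huy, hlog]
  exact mul_left_cancel₀ (two_mul_p_ne_zero p) hfix

/-- **`log(I_v) ⊆ I_v` at the `ℚ_p` datum**: the Iwasawa logarithm (L4's `padicLogAlgCl`; `log 0 = 0`, `log p = 0`)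
maps the printed log-shell into itself. An element of `I_v` is `ℚ_p`-rational, `y = w · p^m` with `w ∈ ℤ_p^×` (or
`y = 0`), and `log y = log w ∈ I_v`. [cite: LANA2026Report, §7.2 (c) p. 40, §5.1 p. 26] -/
theorem padicLogAlgCl_mem_printedLogShell {y : PadicAlgCl p} (hy : y ∈ printedLogShell p) :
    padicLogAlgCl p y ∈ printedLogShell p := by
  obtain ⟨x, rfl⟩ := printedLogShell_subset_range p hy
  by_cases hx : x = 0
  · rw [hx, map_zero, padicLogAlgCl_zero]
    exact (printedLogShell p).zero_mem
  -- unit part `w := x · p^{-v(x)}`, of norm one, `ℚ_p`-rational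
  set w : ℚ_[p] := x * (p : ℚ_[p]) ^ (-x.valuation) with hw
  have hw1 : ‖algebraMap ℚ_[p] (PadicAlgCl p) w‖ = 1 := by
    rw [PadicAlgCl.norm_extends, Literature.NumberTheory.EllipticCurves.norm_mul_zpow_neg_valuation hx]
  have hp0 : (p : ℚ_[p]) ≠ 0 := by exact_mod_cast (Fact.out : p.Prime).ne_zero
  have hp0' : (p : PadicAlgCl p) ≠ 0 := by exact_mod_cast (Fact.out : p.Prime).ne_zero
  have hxw : x = w * (p : ℚ_[p]) ^ x.valuation := by
    rw [hw, mul_assoc, ← zpow_add₀ hp0, neg_add_cancel, zpow_zero, mul_one]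
  have hw0 : algebraMap ℚ_[p] (PadicAlgCl p) w ≠ 0 := norm_ne_zero_iff.mp (by rw [hw1]; exact one_ne_zero)
  -- `log x = log w + log p^{v(x)} = log w`
  have hlog : padicLogAlgCl p (algebraMap ℚ_[p] (PadicAlgCl p) x) =
      padicLogAlgCl p (algebraMap ℚ_[p] (PadicAlgCl p) w) := by
    rw [hxw, map_mul, map_zpow₀, map_natCast, IwasawaLog.log_mul hw0 (zpow_ne_zero _ hp0'),
      (padicLogAlgCl_isIwasawaLog_holds p).log_prime_zpow, add_zero]
  rw [hlog]
  -- `w` is an invariant unit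
  let W : unitGrp (padicVal p) := ⟨_, mem_unitGrp_of_norm_eq_one p hw1⟩
  have hWval : ((W : (PadicAlgCl p)ˣ) : PadicAlgCl p) = algebraMap ℚ_[p] (PadicAlgCl p) w := rfl
  have hWinv : W ∈ unitInv (padicVal p) (PadicGal p) :=
    mem_unitInv_of_forall_smul p W fun σ => by rw [hWval, AlgEquiv.smul_def, AlgEquiv.commutes]
  rw [← hWval]
  exact padicLogAlgCl_mem_printedLogShell_of_unitInv p W hWinv

/-! ## 2. The model column of Fig. 5 at `ℚ_p` and its upper semi-compatibility -/

/-- **The tautological model of LANA's Fig. 5 column at the `ℚ_p` datum**: all Frobenius-like carriers and the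
étale-like carrier are `ℚ̄_p`, all log-shells are the printed `I_v`, the log-links are the (total) Iwasawa
logarithm, the Kummer maps are the identity. [cite: LANA2026Report, §7.2 (b) p. 38] -/
def padicColumn : LogKummerColumn where
  C _ := PadicAlgCl p
  I _ := printedLogShell p
  log _ := padicLogAlgCl p
  E := PadicAlgCl p
  etI := printedLogShell p
  Kmm _ := id

/-- In the model column, `k` log-shifts keep the log-shell inside itself. [cite: LANA2026Report, §7.2 (c) p. 40] -/
theorem padicColumn_shift_mem (n : ℤ) (k : ℕ) {x : PadicAlgCl p} (hx : x ∈ printedLogShell p) :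
    ((padicColumn p).shift n k x : PadicAlgCl p) ∈ printedLogShell p := by
  induction k with
  | zero => exact hx
  | succ k ih =>
    change padicLogAlgCl p ((padicColumn p).shift n k x) ∈ printedLogShell p
    exact padicLogAlgCl_mem_printedLogShell p ih

/-- **UPPER SEMI-COMPATIBILITY HOLDS for the model column at `ℚ_p` (PROVED)**: gen 0's `UpperSemiCompatible` (L6's
`UpperSemiCommutative étI (images after shifts)`, [IUTchIII] Rem. 1.2.2 (iii) as typed) — "even after undergoing a
shift by the log-link, all required images remain within the log-shell" — for REAL objects.
[cite: LANA2026Report, §7.2 (c) p. 40] -/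
theorem padicColumn_upperSemiCompatible : (padicColumn p).UpperSemiCompatible := by
  rintro ⟨n, k⟩ _ ⟨_, ⟨x, hx, rfl⟩, rfl⟩
  exact padicColumn_shift_mem p n k hx

/-- Hence the union of ALL images, over all levels and all numbers of shifts, lies in `I_v` (gen 0's
`iUnion_images_subset`, now for real data). [cite: LANA2026Report, §7.2 (c) p. 40] -/
theorem padicColumn_iUnion_images_subset :
    (⋃ i, (padicColumn p).imageAfterShifts i) ⊆ (printedLogShell p : Set (PadicAlgCl p)) :=
  (padicColumn p).iUnion_images_subset (padicColumn_upperSemiCompatible p)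

/-- The model column does NOT commute (§7.2 (b) "far from commutative") as soon as `log` moves some element: e.g.
`log 1 = 0 ≠ 1 = Kmm 1`. [cite: LANA2026Report, §7.2 (b) p. 38] -/
theorem padicColumn_not_commutes : ¬ (padicColumn p).Commutes := by
  intro h
  have h1 := h 0 (1 : PadicAlgCl p)
  change padicLogAlgCl p 1 = 1 at h1
  rw [(padicLogAlgCl_isIwasawaLog_holds p).log_one] at h1
  exact zero_ne_one h1

end IUTFork

end Summit.ABC

end
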